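import Summits.BirchSwinnertonDyer.BirchSwinnertonDyer.Theorems.SemiOrdinaryEisensteinDescentShaTwoCochainBridgePackageMu
import Summits.BirchSwinnertonDyer.BirchSwinnertonDyer.Theorems.ThetaPartnerAtTwoSignedControlAtTwoShaThreeBaseH3Units
import Literature.NumberTheory.EllipticCurves.CasselsTateGeneralCaseLocal
import Literature.NumberTheory.GaloisRepresentations.LocalDualityTheorem
import HarnessLib

/-!
# The Ш²-cochain bridge over a number field WITH REAL PLACES, step 1: the bridge package with `Ш³(K, μₙ) = 0` in place of
# `H³(K, μₙ) = 0`

Route `GenusKolyvaginAtTwo`, crux `KolyvaginExactAtTwo` (stmt-BirchSwinnertonDyer-22137) → Q3-inner, Cassels–Tate block at the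
EVEN level OVER `ℚ`; seat `bsd-line-gk2-p2` g13 (cell `bsd-f1-sign2`), `--supports 22137`, helper. THEOREMS ONLY (no definition, no
named fact, no `sorry`, no instance).

Cell `bsd-wall`'s Ш²-cochain bridge (item 20191; `Theorems/SemiOrdinaryEisensteinDescentShaTwoCochain*.lean`) proves the input `hPTc`
(Milne I Thm. 4.10 (a) for `Ш²(K, E[m])` in `PTChoice` cochain form) of the tree's Cassels–Tate recipe at ODD level; this seat ported it
to every level over a TOTALLY COMPLEX field (`…CasselsTatePTcTotallyComplex`). Over a field with a REAL place (e.g. `ℚ`, the LINE 6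
capstone and route item 19420 `CasselsTatePairingRat`) and even level, the first odd-level shortcut to remove is the use of
`H³(K, μₙ) = 0` (`H³(ℝ, μ_{2^k}) = ℤ/2`): the bridge needs it only to write the `3`-cocycle `F♭ ∪ γ` as a coboundary, and `γ` is
LOCALLY TRIVIAL in the application, so `Ш³(K, μₙ) = 0` (Milne I 4.10 (c)₃ — the tree theorem
`ShaThreeBrauer.poitouTate_three_realPlaces_injective_holds`) suffices:

* §1 `threeCocycleClass_cupCocycle₂₁_eq_zero_of_locallyTrivial` — for `γ ∈ Z¹(K, M)` locally trivial at the REAL places and ANY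
  `F♭ ∈ Z²(K, M^D)`: `[F♭ ∪ γ] = 0` in `H³(K, μₙ)` (at a real place `γ` is principal, so the restricted cup product is a coboundary —
  the tree's `ContPairing.threeCocycleClass_cupCocycle₂₁_eq_zero_of_right`; then 4.10 (c)₃);
* §2 `exists_bridgePackageMu_of_cupVanishing` — w3 g7's `exists_bridgePackageMu` with `hH3` replaced by that cup vanishing (one line
  of the proof changes).

Sequel files carry the archimedean terms through the bridge sum and the readout. BSD is not proved by any of this.

References: [MilneADT2006] I Thm. 4.10 (a) (proof p. 58), (c), Lemma 4.13; [NeukirchSchmidtWingberg2008] (1.3.2), Prop. 1.4.1, (1.5.2);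
[SerreGaloisCohomology1997] I §2.4.
-/

noncomputable section

-- `Summit.<P>.<Sub>` repeats `BirchSwinnertonDyer` by the tree's layout convention (D-0017)
set_option linter.dupNamespace false
set_option autoImplicit false

namespace Summit.BirchSwinnertonDyer.BirchSwinnertonDyer.Theorems.GenusExact.CasselsTatePTcReal

open CategoryTheory NumberField Function
open Literature.NumberTheory.EllipticCurves
open Literature.NumberTheory.GaloisRepresentations Literature.NumberTheory.GaloisRepresentations.HomDual
  Literature.NumberTheory.GaloisCohomology
open Literature.Algebra.Homology Literature.Algebra.Homology.DiscreteRep ContRepresentation Field Literature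
open Literature.NumberTheory.GaloisRepresentations.DiscreteGaloisModule (units UnitsCarrier mu MuCarrier TateDual tateDual
  tateDualPairing)
open Literature.NumberTheory.GaloisRepresentations.IdeleClassBar (classBarD)
open Literature.NumberTheory.GaloisRepresentations.FreePresentation
open Literature.NumberTheory.GaloisRepresentations.DGMBridge
open Summit.BirchSwinnertonDyer.BirchSwinnertonDyer.Theorems.ShaTwoCochain
open scoped ContRepresentation

/-! ## §1 `[F♭ ∪ γ] = 0` in `H³(K, μₙ)` for `γ` locally trivial at the real places -/

section CupVanishing

variable {K : Type} [Field K] [NumberField K]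
variable {M : Type} [AddCommGroup M] [TopologicalSpace M] [DiscreteTopology M] [Finite M]

/-- **`[F♭ ∪ γ] = 0` in `H³(K, μₙ)` for every `2`-cocycle `F♭` of `M^D = Hom(M, μₙ)`, as soon as the `1`-cocycle `γ` of `M` is
locally trivial at the REAL places**: at a real `w`, `γ|_{Γ_{K_w}}` is principal, so `(F♭ ∪ γ)|_{Γ_{K_w}} = F♭|_w ∪ γ|_w` is a
coboundary (`threeCocycleClass_cupCocycle₂₁_eq_zero_of_right`), i.e. `loc_w [F♭ ∪ γ] = 0`; a class of `H³(K, μₙ)` vanishing at every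
real place is `0` (Milne I 4.10 (c)₃, `ShaThreeBrauer.poitouTate_three_realPlaces_injective_holds`).
[cite: MilneADT2006, Ch. I, Thm. 4.10 (c)] [cite: SerreGaloisCohomology1997, I §2.4] -/
theorem threeCocycleClass_cupCocycle₂₁_eq_zero_of_locallyTrivial (ρ : DiscreteGaloisModule K M) (n : ℕ) [NeZero n]
    (γ : contOneCocycles ρ.toTopRep)
    (hγ : ∀ w : InfinitePlace K, w.IsReal →
      locClass ρ (Place.Completion (Sum.inl w : Place K)) (resOne ρ (Place.Completion (Sum.inl w : Place K)) γ) = 0)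
    (Fb : contTwoCocycles (ρ.tateDual n).toTopRep) :
    haveI := absoluteGaloisGroup_compactSpace K
    threeCocycleClass _ ((tateDualPairing ρ n).flip.cupCocycle₂₁ Fb γ) = 0 := by
  haveI := absoluteGaloisGroup_compactSpace K
  haveI : Finite (MuCarrier K n) := finite_muCarrier K n
  refine SignedEC.ShaThreeBrauer.poitouTate_three_realPlaces_injective_holds K (MuCarrier K n) (mu K n) _ fun w hw => ?_
  haveI := absoluteGaloisGroup_compactSpace (Place.Completion (Sum.inl w : Place K))
  change galoisCohomology.res (mu K n) (Place.Completion (Sum.inl w : Place K)) 3 _ = 0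
  rw [← threeCocycleClass_resThree]
  have hzz : resThree (mu K n) (Place.Completion (Sum.inl w : Place K)) ((tateDualPairing ρ n).flip.cupCocycle₂₁ Fb γ) =
      (((tateDualPairing ρ n).flip).restrict (absGaloisRestrict K (Place.Completion (Sum.inl w : Place K)))).cupCocycle₂₁
        (resTwo (ρ.tateDual n) (Place.Completion (Sum.inl w : Place K)) Fb)
        (resOne ρ (Place.Completion (Sum.inl w : Place K)) γ) :=
    Subtype.ext (ContinuousMap.ext fun p => by
      obtain ⟨σ, τ, υ⟩ := p
      rw [resThree_apply, ContPairing.cupCocycle₂₁_apply, ContPairing.cupCocycle₂₁_apply,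
        ContPairing.restrict_toLin, resTwo_apply, resOne_apply, resOne_apply]
      simp only [map_mul (absGaloisRestrict K (Place.Completion (Sum.inl w : Place K)))])
  rw [hzz]
  obtain ⟨v, hv⟩ := (oneCocycleClass_eq_zero_iff _ _).1 (hγ w hw)
  exact ContPairing.threeCocycleClass_cupCocycle₂₁_eq_zero_of_right _ _ _ ⟨v, hv⟩

end CupVanishing

/-! ## §2 The bridge package with the weakened `H³` input -/

section Package

variable {K : Type} [Field K] [NumberField K]
variable {M : Type} [AddCommGroup M] [TopologicalSpace M] [DiscreteTopology M] [Finite M]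
variable (ρ : DiscreteGaloisModule K M) (n : ℕ) [NeZero n] (hM : ∀ m : M, n • m = 0)

/-- **The Ш²-cochain bridge, packaged in `μₙ`-currency, with the `H³` input WEAKENED to the vanishing of the cup products
`[F♭ ∪ γ] ∈ H³(K, μₙ)` against the given `γ`** (`hH3γ`; it holds whenever `Ш³(K, μₙ) = 0` and `γ` is locally trivial at the real
places, `threeCocycleClass_cupCocycle₂₁_eq_zero_of_locallyTrivial`) — otherwise VERBATIM cell bsd-wall's
`ShaTwoCochain.exists_bridgePackageMu` (w3 g7), which demanded `H³(K, μₙ) = 0` outright (false at even `n` over a field with a real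
place). Conjuncts (1♭)–(6♭) unchanged. [cite: MilneADT2006, I Thm. 4.10 (a) (proof, p. 58), Lemma 4.13]
[cite: NeukirchSchmidtWingberg2008, (1.3.2), Prop. 1.4.1, (1.5.2)] -/
theorem exists_bridgePackageMu_of_cupVanishing
    (h : (presentationComplex ρ).X₁ ⟶ classBarD K) (γ : contOneCocycles ρ.toTopRep)
    (hH3γ : haveI := absoluteGaloisGroup_compactSpace K
      ∀ Fb : contTwoCocycles (ρ.tateDual n).toTopRep, threeCocycleClass _ ((tateDualPairing ρ n).flip.cupCocycle₂₁ Fb γ) = 0) :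
    haveI := moduleFinite_presModule₁ ρ
    haveI := moduleFinite_presModule₂ ρ
    haveI := absoluteGaloisGroup_compactSpace K
    ∃ (Fb : contTwoCocycles (ρ.tateDual n).toTopRep)
      (Hb : C(absoluteGaloisGroup K × absoluteGaloisGroup K, MuCarrier K n))
      (c : contTwoCocycles (presModule₁ ρ).toTopRep)
      (ht : DiscreteRep.HomCarrier (LCarrier (presentationComplex ρ).X₁) (LCarrier (ideleBarD K)))
      (Z : contTwoCocycles (toDGM (ideleBarD K)).toTopRep),
      -- (1♭) `Ψ h = [F♭]`
      shaTwoConnecting ρ n hM h = twoCocycleClass _ Fb ∧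
      -- (2♭) `dH♭ = F♭ ∪ γ` for the evaluation pairing (S1′'s `hh`)
      (∀ σ τ υ : absoluteGaloisGroup K,
        ((tateDualPairing ρ n).flip.cupCocycle₂₁ Fb γ).1 (σ, τ, υ) = dTwo (mu K n).toTopRep Hb σ τ υ) ∧
      -- (3) `h̃` lifts `h` along `J̄ → C̄`
      (∀ x : LCarrier (presentationComplex ρ).X₁,
        ideleToClassI K ((show _ →ₗ[ℤ] LCarrier (ideleBarD K) from ht) x) =
          lmap (presentationComplex ρ).X₁ (classBarD K) h x) ∧
      -- (4) `[c] = δ₁[γ]` for `0 → N₁ → P → M → 0`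
      (pres_isSES ρ).δ₁ (oneCocycleClass _ γ) = twoCocycleClass _ c ∧
      -- (5) the idèle-class image of `Z` is `h ∘ c`
      (∀ σ τ : absoluteGaloisGroup K,
        ideleToClassI K (Z.1 (σ, τ)) = lmap (presentationComplex ρ).X₁ (classBarD K) h (c.1 (σ, τ))) ∧
      -- (6♭) the local primitives in `μₙ`-currency (S1′'s `hφ`) and the comparison with `π_v Z`, on the nose
      (∀ (v : Place K) (π : HomDual.IdeleProjection K v),
        ∃ (φb : C(absoluteGaloisGroup (Place.Completion v), TateDual K M n))
          (lam : C(absoluteGaloisGroup (Place.Completion v), UnitsCarrier (Place.Completion v))),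
          (∀ σ' τ' : absoluteGaloisGroup (Place.Completion v),
            (resTwo (ρ.tateDual n) (Place.Completion v) Fb).1 (σ', τ') =
              (DiscreteGaloisModule.toTopRep (GaloisRep.restrictField (Place.Completion v) (ρ.tateDual n))).ρ σ' (φb τ') -
                φb (σ' * τ') + φb σ') ∧
          (∀ σ' τ' : absoluteGaloisGroup (Place.Completion v),
            unitsTransferAddHom K (Place.Completion v) (kummerInclAddHom K n
                ((show MuCarrier K n from
                    (φb σ') (ρ (absGaloisRestrict K (Place.Completion v) σ') (γ.1 (absGaloisRestrict K (Place.Completion v) τ')))) -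
                  Hb (absGaloisRestrict K (Place.Completion v) σ', absGaloisRestrict K (Place.Completion v) τ'))) =
            (π.toAddMonoidHom.comp (LCarrier.val (ideleBarD K)))
                (Z.1 (absGaloisRestrict K (Place.Completion v) σ', absGaloisRestrict K (Place.Completion v) τ')) -
              (units (Place.Completion v) σ' (lam τ') - lam (σ' * τ') + lam σ'))) := by
  haveI := moduleFinite_presModule₁ ρ
  haveI := moduleFinite_presModule₂ ρ
  haveI := absoluteGaloisGroup_compactSpace K
  -- the global data (G): `h̃, ξ, ξ̃, F`
  obtain ⟨ht, ξ, ξt, F, -, -, hht, hξ, hξt, hF, -, -, hΨ⟩ := exists_bridgeGlobalData ρ n hM h γ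
  -- `F♭ := e⁻¹ ∘ F`
  let Fb : contTwoCocycles (ρ.tateDual n).toTopRep :=
    contTwoCocycles.pullback (ContinuousMonoidHom.id _) (resIdHom (tateDualUnitsIso K ρ n hM).inv) F
  have hFb : ∀ (σ τ : absoluteGaloisGroup K) (m : M),
      kummerInclAddHom K n ((Fb.1 (σ, τ)) m) = (show M →ₗ[ℤ] UnitsCarrier K from F.1 (σ, τ)) m := by
    intro σ τ m
    have e1 : (tateDualUnitsIso K ρ n hM).hom.hom ((tateDualUnitsIso K ρ n hM).inv.hom (F.1 (σ, τ))) = F.1 (σ, τ) := by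
      rw [← TopRep.comp_apply, (tateDualUnitsIso K ρ n hM).inv_hom_id]
      rfl
    exact congrArg (fun Φ : DiscreteRep.HomCarrier M (UnitsCarrier K) => (show M →ₗ[ℤ] UnitsCarrier K from Φ) m) e1
  have hΨb : shaTwoConnecting ρ n hM h = twoCocycleClass _ Fb := by
    rw [hΨ, cohomologyMap_twoCocycleClass]
  -- `H♭` from `H³(K, μₙ) = 0`, and `H := κ ∘ H♭`
  obtain ⟨Hb, hHb⟩ := (threeCocycleClass_eq_zero_iff_dTwo _ _).1 (hH3γ Fb)
  let H : C(absoluteGaloisGroup K × absoluteGaloisGroup K, UnitsCarrier K) :=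
    ⟨fun q => (kummerι K n).hom (Hb q), (kummerι K n).hom.toContinuousLinearMap.continuous.comp Hb.continuous⟩
  have hH : ∀ σ τ υ : absoluteGaloisGroup K,
      (show M →ₗ[ℤ] UnitsCarrier K from F.1 (σ, τ)) (ρ (σ * τ) (γ.1 υ)) = dTwo (units K).toTopRep H σ τ υ := by
    intro σ τ υ
    have hι : ∀ x, (units K) σ ((kummerι K n).hom x) = (kummerι K n).hom ((mu K n) σ x) :=
      fun x => (ContinuousRep.hom_comm_apply (kummerι K n) σ x).symm
    have hd : dTwo (units K).toTopRep H σ τ υ = (kummerι K n).hom (dTwo (mu K n).toTopRep Hb σ τ υ) := by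
      simp only [H, dTwo_apply, ContinuousMap.coe_mk, map_sub, map_add, ContinuousRep.toContRepresentation_apply_apply, hι]
    rw [hd, ← hHb, ContPairing.cupCocycle₂₁_apply, ContPairing.flip_toLin_apply, contOneCocycles.apply_mul_sub]
    exact (hFb σ τ _).symm
  -- the canonical lift `γ̃` of `γ` and its connecting cocycle `c`, with `δ₁[γ] = [c]`
  let γt : C(absoluteGaloisGroup K, LCarrier (presentationComplex ρ).X₂) := (pres_isSES ρ).liftCocycle γ
  let c : contTwoCocycles (presModule₁ ρ).toTopRep :=
    (pres_isSES ρ).connectingCocycle γt ((pres_isSES ρ).liftCocycle_isLift γ)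
  have hγt : ∀ σ : absoluteGaloisGroup K, presProj ρ (γt σ) = γ.1 σ := fun σ => (pres_isSES ρ).g_liftCocycle_apply γ σ
  have hc : ∀ σ τ : absoluteGaloisGroup K,
      presIncl ρ (c.1 (σ, τ)) = (presModule₂ ρ) σ (γt τ) - γt (σ * τ) + γt σ := fun σ τ =>
    (pres_isSES ρ).f_connectingCocycle_apply γt ((pres_isSES ρ).liftCocycle_isLift γ) σ τ
  have hδ : (pres_isSES ρ).δ₁ (oneCocycleClass _ γ) = twoCocycleClass _ c := by
    have e := (pres_isSES ρ).δ₁_oneCocycleClass γt ((pres_isSES ρ).liftCocycle_isLift γ)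
    rw [(pres_isSES ρ).pushCocycle_liftCocycle γ] at e
    exact e
  -- the continuous bridge cochain `B` and the bridge cocycle `Z = B − uJ ∘ H`
  obtain ⟨B, hB⟩ := exists_bridgeCochain ρ ht ξt γt c hc
  let Zc : C(absoluteGaloisGroup K × absoluteGaloisGroup K, LCarrier (ideleBarD K)) :=
    ⟨fun q => B q - unitsToIdeleI K (H q),
      B.continuous.sub ((unitsToIdeleI K).toContinuousLinearMap.continuous.comp H.continuous)⟩
  have hZ : ∀ σ τ : absoluteGaloisGroup K, Zc (σ, τ) = B (σ, τ) - unitsToIdeleI K (H (σ, τ)) := fun _ _ => rfl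
  have hZmem : Zc ∈ contTwoCocycles (toDGM (ideleBarD K)).toTopRep :=
    bridgeCocycle_mem (presIncl ρ) (presProj ρ) (unitsToIdeleI K) ht ξ hξ ξt hξt F.1 hF γ γt hγt c.1 hc c.2 B hB H hH Zc hZ
  have hlift : ∀ x : LCarrier (presentationComplex ρ).X₁,
      ideleToClassI K ((show _ →ₗ[ℤ] LCarrier (ideleBarD K) from ht) x) = lmap (presentationComplex ρ).X₁ (classBarD K) h x := by
    intro x
    exact congrArg (fun Φ : DiscreteRep.HomCarrier (LCarrier (presentationComplex ρ).X₁) (LCarrier (classBarD K)) =>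
      (show _ →ₗ[ℤ] LCarrier (classBarD K) from Φ) x) hht
  have hjU : ∀ u : UnitsCarrier K, ideleToClassI K (unitsToIdeleI K u) = 0 := fun u => (idele_isSES K).g_f_apply u
  refine ⟨Fb, Hb, c, ht, ⟨Zc, hZmem⟩, hΨb, hHb, hlift, hδ, fun σ τ => ?_, fun v π => ?_⟩
  · -- (5)
    rw [← hlift]
    exact idele_class_of_bridgeCocycle (uJ := unitsToIdeleI K) (ideleToClassI K) hjU ht ξt γt c.1 B hB H Zc hZ σ τ
  · -- (6♭) at the place `v` for `π_v`
    haveI : CharZero (Place.Completion v) := charZero_placeCompletion v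
    have hπ := ideleProjection_toDGM_smul π
    obtain ⟨ηt, φ, hηt, hφ⟩ := exists_bridgeLocalData (presIncl ρ) (presProj ρ) (pres_isSES ρ) (unitsToIdeleI K)
      (π.toAddMonoidHom.comp (LCarrier.val (ideleBarD K))) hπ ht ξ ξt hξ hξt
    -- `j = ι_v ∘ κ = κ_v ∘ μ-transfer` intertwines the actions
    have hjsmul : ∀ (σ' : absoluteGaloisGroup (Place.Completion v)) (ζ : MuCarrier K n),
        unitsTransferAddHom K (Place.Completion v) (kummerInclAddHom K n (mu K n (absGaloisRestrict K (Place.Completion v) σ') ζ)) =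
          units (Place.Completion v) σ' (unitsTransferAddHom K (Place.Completion v) (kummerInclAddHom K n ζ)) := by
      intro σ' ζ
      rw [← unitsTransferAddHom_smul]
      exact congrArg (unitsTransferAddHom K (Place.Completion v))
        (ContinuousRep.hom_comm_apply (kummerι K n) (absGaloisRestrict K (Place.Completion v) σ') ζ)
    -- the `μₙ`-reading `φ♭` of `φ`: `j ∘ φ♭(σ') = φ(σ')`
    let ψ : DiscreteRep.HomCarrier M (UnitsCarrier (Place.Completion v)) → TateDual K M n := fun G =>
      (show TateDual K M n from
        ((muTransferEquiv K (Place.Completion v) n).symm.toAddMonoidHom.comp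
          (show M →+ MuCarrier (Place.Completion v) n from homMuUnitsInv (Place.Completion v) n hM G)))
    let φb : C(absoluteGaloisGroup (Place.Completion v), TateDual K M n) :=
      ⟨ψ ∘ φ, (continuous_of_discreteTopology (f := ψ)).comp φ.continuous⟩
    have hφb : ∀ (σ' : absoluteGaloisGroup (Place.Completion v)) (m : M),
        unitsTransferAddHom K (Place.Completion v) (kummerInclAddHom K n ((φb σ') m)) =
          (show M →ₗ[ℤ] UnitsCarrier (Place.Completion v) from φ σ') m := by
      intro σ' m
      change unitsTransferAddHom K (Place.Completion v) (kummerInclAddHom K n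
        ((muTransferEquiv K (Place.Completion v) n).symm
          ((show M →+ MuCarrier (Place.Completion v) n from homMuUnitsInv (Place.Completion v) n hM (φ σ')) m))) = _
      rw [unitsTransferAddHom_kummerInclAddHom, ← muTransferEquiv_apply, AddEquiv.apply_symm_apply]
      exact congrArg (fun Φ : DiscreteRep.HomCarrier M (UnitsCarrier (Place.Completion v)) =>
        (show M →ₗ[ℤ] UnitsCarrier (Place.Completion v) from Φ) m)
        (homMuUnits_homMuUnitsInv (Place.Completion v) n hM (show M →ₗ[ℤ] UnitsCarrier (Place.Completion v) from φ σ'))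
    have hj : Function.Injective (fun ζ : MuCarrier K n =>
        unitsTransferAddHom K (Place.Completion v) (kummerInclAddHom K n ζ)) := by
      intro ζ₁ ζ₂ hζ
      dsimp only at hζ
      rw [unitsTransferAddHom_kummerInclAddHom, unitsTransferAddHom_kummerInclAddHom] at hζ
      exact muTransfer_injective K _ n (kummerInclAddHom_injective _ n hζ)
    refine ⟨φb, ⟨fun σ' => (show _ →ₗ[ℤ] UnitsCarrier (Place.Completion v) from ηt)
        (γt (absGaloisRestrict K (Place.Completion v) σ')),
      (continuous_of_discreteTopology (f := fun y : LCarrier (presentationComplex ρ).X₂ =>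
        (show _ →ₗ[ℤ] UnitsCarrier (Place.Completion v) from ηt) y)).comp
        (γt.continuous.comp (absGaloisRestrict K (Place.Completion v)).continuous)⟩,
      fun σ' τ' => ?_, fun σ' τ' => ?_⟩
    · -- `F♭|_v = dφ♭` : test against the injective `j`, pointwise in `z = p y`
      refine TateDual.ext fun z => hj ?_
      obtain ⟨y, hy⟩ := (pres_isSES ρ).surjective z
      change presProj ρ y = z at hy
      have h6a := dOne_bridgePrimitive (presProj ρ) (unitsToIdeleI K)
        (π.toAddMonoidHom.comp (LCarrier.val (ideleBarD K))) hπ ξt F.1 hF ηt φ hφ σ' τ' y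
      rw [hy, ideleProjection_unitsToIdeleI π, unitsTransfer_apply] at h6a
      change units (Place.Completion v) σ' ((show M →ₗ[ℤ] UnitsCarrier (Place.Completion v) from φ τ')
          (ρ (absGaloisRestrict K (Place.Completion v) σ'⁻¹) z)) - _ + _ = _ at h6a
      rw [map_inv, ← hφb, ← hφb, ← hφb, ← hjsmul, ← map_sub, ← map_sub, ← map_add, ← map_add] at h6a
      dsimp only
      rw [resTwo_apply, hFb]
      exact h6a.symm
    · -- `j (φ♭ ∪ γ − H♭) = π_v Z − dλ`
      have h6b := bridgeLocalCocycle_eq (presIncl ρ) (presProj ρ) (unitsToIdeleI K)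
        (π.toAddMonoidHom.comp (LCarrier.val (ideleBarD K))) ht ξt γ γt hγt c.1 hc B hB H Zc hZ ηt hηt φ hφ σ' τ'
      rw [ideleProjection_unitsToIdeleI π, unitsTransfer_apply] at h6b
      rw [map_sub, map_sub, hφb]
      exact h6b

end Package

end Summit.BirchSwinnertonDyer.BirchSwinnertonDyer.Theorems.GenusExact.CasselsTatePTcReal

end
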